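import Literature.Geometry.ComplexAnalytic.PhamBrieskornA3Involution
import Literature.Geometry.ComplexAnalytic.PhamBrieskornCyclicNodeCohomology
import HarnessLib

/-!
# The involution `ι` of the `A₃` Milnor fibre in COHOMOLOGY: `ι^* = −(σ^*)²` on `H²(F)`, the `ι`-invariant classes are
# `ker((σ^*)² + 1)`, `H²(F) = ker(σ^* + 1) ⊕ ker((σ^*)² + 1)`, `dim_ℚ ker((σ^*)² + 1)` even `≤ 2` (Kronecker duality)

Family `hodge`, layer `Literature/Geometry/ComplexAnalytic`; sequel of `PhamBrieskornA3Involution` (the same statements in singular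
HOMOLOGY) and `PhamBrieskornCyclicNodeCohomology` (route A's transfer `Σ_{i<p} (σ^*)^i = 0`). Written by the prover seat
`hodge-nonav-prover-Ax` (g18), brick L6-3 of the LOC6 plan for crux K1Q `VeryGeneralQuaternionCommutatorsInHg` (route
`Summits/HodgeConjecture/HodgeConjecture/Theses/Q8SymplecticPowers.lean`, stub S5): the monodromy of the quaternionic quartic family acts on
the COHOMOLOGY `H²(X_s; ℚ)` of the members (`bettiCohomology`), so the local package is needed on `H²(F; F)`. Over a field the Kronecker map
`Hⁿ(X; F) → Hom(Hₙ(X; F), F)` is injective and natural (Hatcher §3.1 Thm. 3.2, p. 198, p. 201; tree `kroneckerPairing_injective_of_field`,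
`kroneckerPairing_map`), so monomial relations `g_*^i = c · f_*^j` transfer to `(g^*)^i = c · (f^*)^j`:

* §1 `cohomologyMap_pow_eq_smul_pow_of_homology` — the transfer tool.
* §2 **`cohomologyMap_iotaFibre_eq_neg_sq`: `ι^* = −(τ^*)²`** on `H²` of the Milnor fibre of `z₀² + z₁² + z₂⁴` (`τ^* = σ_ζ^*`, `ζ` a
  primitive 4th root), **`cohomologyMap_iotaFibre_eq_self_iff`: `ι^* a = a ↔ (τ^*)² a = −a`**, `(τ^*)⁴ = 1`, and
  **`isCompl_ker_cohomologyTauFour`: `H²(F) = ker(τ^* + 1) ⊕ ker((τ^*)² + 1)`** (any field of characteristic zero).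
* §3 **`finrank_ker_cohomologyTauFour_sq_add_one_le_two`**: over `ℚ`, `dim ker((τ^*)² + 1)` is even and `≤ 2`, `dim ker(τ^* + 1) ≥ 1`
  (`dim_ℚ H²(F; ℚ) = 3`).

No HC content; no named fact; rung F-H1 not moved.

## References

* [Milnor1968] J. Milnor, Singular Points of Complex Hypersurfaces, Ann. of Math. Studies 61 (1968), §9, Thm. 9.1 and p. 77.
* [CarlsonToledo1999] J. A. Carlson, D. Toledo, Discriminant complements and kernels of monodromy representations, Duke Math. J.
  97 (1999), §6 (held text p0013–p0014).
* [HatcherAT2002] A. Hatcher, Algebraic Topology, CUP 2002, §3.1 Thm. 3.2 (p. 195), p. 198, p. 201.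
-/

noncomputable section

open Complex ContinuousMap Set CategoryTheory
open Literature.AlgebraicTopology.SingularHomology

namespace Literature.Geometry.ComplexAnalytic

namespace PhamBrieskorn

/-! ### §1 Transfer of monomial relations from homology to cohomology -/

section Transfer

variable (F : Type) [Field F] {X : Type} [TopologicalSpace X]

/-- **Over a field, `g_*^i = c · f_*^j` on `Hₙ(X; F)` implies `(g^*)^i = c · (f^*)^j` on `Hⁿ(X; F)`** (pair with a class and use the
injectivity and naturality of the Kronecker map). [cite: HatcherAT2002, §3.1 Thm. 3.2 (p. 195), p. 198 and p. 201] -/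
theorem cohomologyMap_pow_eq_smul_pow_of_homology (f g : C(X, X)) (n i j : ℕ) (c : F)
    (h : ∀ z : singularHomology F F X n,
      ((singularHomology.map F F g n).hom ^ i) z = c • ((singularHomology.map F F f n).hom ^ j) z)
    (a : singularCohomology F F X n) :
    ((singularCohomology.map F F g n).hom ^ i) a = c • ((singularCohomology.map F F f n).hom ^ j) a := by
  apply kroneckerPairing_injective_of_field F X n
  refine LinearMap.ext fun z => ?_
  rw [kroneckerPairing_pow_cohomologyMap, h z, map_smul, map_smul, LinearMap.smul_apply, kroneckerPairing_pow_cohomologyMap]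

end Transfer

/-! ### §2 `ι^*` on `H²(F)` for the Milnor fibre of `z₀² + z₁² + z₂⁴` -/

section Cohomology

variable (F : Type) [Field F] {ζ : ℂ} (hζ : IsPrimitiveRoot ζ 4)

/-- The covering rotation `σ_ζ` on `H²(F; F)` as an `F`-linear map `τ^*`. [cite: Milnor1968, §9 p. 77] -/
abbrev cohomologyTauFour : singularCohomology F F (fibre (cyclicNodeExponents 4)) 2 →ₗ[F]
    singularCohomology F F (fibre (cyclicNodeExponents 4)) 2 :=
  (singularCohomology.map F F (rotateFibre (cyclicNodeExponents 4) (cyclicNodeExponents_ne_zero 4 four_ne_zero) ⟨ζ, hζ.pow_eq_one⟩ :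
    C(fibre (cyclicNodeExponents 4), fibre (cyclicNodeExponents 4))) 2).hom

/-- `(τ^*)⁴ = 1`. [cite: Milnor1968, §9 p. 77] [cite: HatcherAT2002, §3.1 p. 201] -/
theorem cohomologyTauFour_pow_four (a : singularCohomology F F (fibre (cyclicNodeExponents 4)) 2) :
    (cohomologyTauFour F hζ ^ 4) a = a := by
  have h := cohomologyMap_pow_eq_smul_pow_of_homology F
    (rotateFibre (cyclicNodeExponents 4) (cyclicNodeExponents_ne_zero 4 four_ne_zero) ⟨ζ, hζ.pow_eq_one⟩ :
      C(fibre (cyclicNodeExponents 4), fibre (cyclicNodeExponents 4)))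
    (rotateFibre (cyclicNodeExponents 4) (cyclicNodeExponents_ne_zero 4 four_ne_zero) ⟨ζ, hζ.pow_eq_one⟩ :
      C(fibre (cyclicNodeExponents 4), fibre (cyclicNodeExponents 4))) 2 4 0 1
    (fun z => by rw [one_smul, pow_zero, Module.End.one_apply]; exact congrArg (fun f => f z) (tauFour_pow_four F hζ)) a
  rw [one_smul, pow_zero, Module.End.one_apply] at h
  exact h

/-- **`ι^* = −(τ^*)²` on `H²` of the Milnor fibre of `z₀² + z₁² + z₂⁴`** (transfer of `map_iotaFibre_eq_neg_sq`).
[cite: Milnor1968, §9 Thm. 9.1 and p. 77] [cite: CarlsonToledo1999, §6 (held text p0013–p0014)] [cite: HatcherAT2002, §3.1 p. 201] -/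
theorem cohomologyMap_iotaFibre_eq_neg_sq [CharZero F] (a : singularCohomology F F (fibre (cyclicNodeExponents 4)) 2) :
    singularCohomology.map F F (iotaFibre 4 four_ne_zero (by decide) : C(fibre (cyclicNodeExponents 4), fibre (cyclicNodeExponents 4))) 2 a =
      -((cohomologyTauFour F hζ ^ 2) a) := by
  have h := cohomologyMap_pow_eq_smul_pow_of_homology F
    (rotateFibre (cyclicNodeExponents 4) (cyclicNodeExponents_ne_zero 4 four_ne_zero) ⟨ζ, hζ.pow_eq_one⟩ :
      C(fibre (cyclicNodeExponents 4), fibre (cyclicNodeExponents 4)))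
    (iotaFibre 4 four_ne_zero (by decide) : C(fibre (cyclicNodeExponents 4), fibre (cyclicNodeExponents 4))) 2 1 2 (-1)
    (fun z => by rw [pow_one, neg_one_smul]; exact map_iotaFibre_eq_neg_sq F hζ z) a
  rw [pow_one, neg_one_smul] at h
  exact h

/-- **The `ι`-invariant classes of `H²(F)` are exactly `ker((τ^*)² + 1)`**: `ι^* a = a ↔ (τ^*)² a = −a`.
[cite: Milnor1968, §9 Thm. 9.1 and p. 77] [cite: CarlsonToledo1999, §6 (held text p0013–p0014)] -/
theorem cohomologyMap_iotaFibre_eq_self_iff [CharZero F] (a : singularCohomology F F (fibre (cyclicNodeExponents 4)) 2) :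
    singularCohomology.map F F (iotaFibre 4 four_ne_zero (by decide) : C(fibre (cyclicNodeExponents 4), fibre (cyclicNodeExponents 4))) 2 a =
      a ↔ (cohomologyTauFour F hζ ^ 2) a = -a := by
  rw [cohomologyMap_iotaFibre_eq_neg_sq F hζ, neg_eq_iff_eq_neg]

/-- `1 + τ^* + (τ^*)² + (τ^*)³ = 0` on `H²(F)` (the tree's cohomological `Σ_{i<p} (σ^*)^i = 0` for `p = 4`, any field of characteristic zero
via the transfer tool). [cite: CarlsonToledo1999, §6 (held text p0013)] [cite: HatcherAT2002, §3.1 p. 201] -/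
theorem cohomologyTauFour_sum_eq_zero [CharZero F] (a : singularCohomology F F (fibre (cyclicNodeExponents 4)) 2) :
    a + cohomologyTauFour F hζ a + (cohomologyTauFour F hζ ^ 2) a + (cohomologyTauFour F hζ ^ 3) a = 0 := by
  have h := sum_pow_cohomologyMap_eq_zero F
    (rotateFibre (cyclicNodeExponents 4) (cyclicNodeExponents_ne_zero 4 four_ne_zero) ⟨ζ, hζ.pow_eq_one⟩ :
      C(fibre (cyclicNodeExponents 4), fibre (cyclicNodeExponents 4))) 2 4
    (fun z => by
      have hz := tauFour_sum_eq_zero F hζ z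
      simp only [Finset.sum_range_succ, Finset.sum_range_zero, zero_add, pow_zero, pow_one, Module.End.one_apply]
      exact hz) a
  simp only [Finset.sum_range_succ, Finset.sum_range_zero, zero_add, pow_zero, pow_one, Module.End.one_apply] at h
  exact h

/-- An endomorphism `τ` of a vector space over a field of characteristic zero with `τ⁴ = 1` and `1 + τ + τ² + τ³ = 0` splits the space as
`ker(τ + 1) ⊕ ker(τ² + 1)` (`(X² + 1) − (X + 1)(X − 1) = 2`). [folklore] -/
private theorem isCompl_ker_of_pow_four {K : Type} [Field K] [CharZero K] {V : Type} [AddCommGroup V] [Module K V] (τ : V →ₗ[K] V)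
    (h4 : ∀ x, (τ ^ 2) ((τ ^ 2) x) = x) (hs : ∀ x, x + τ x + (τ ^ 2) x + (τ ^ 3) x = 0) :
    IsCompl (LinearMap.ker (τ + 1)) (LinearMap.ker (τ ^ 2 + 1)) := by
  have h2 : (2 : K) ≠ 0 := two_ne_zero
  have hfac : ∀ x, τ ((τ ^ 2) x + x) + ((τ ^ 2) x + x) = 0 := fun x => by
    rw [map_add, ← Module.End.mul_apply, ← pow_succ', ← hs x]; abel
  refine isCompl_iff.2 ⟨?_, ?_⟩
  · rw [Submodule.disjoint_def]
    intro x hx1 hx2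
    rw [LinearMap.mem_ker, LinearMap.add_apply, Module.End.one_apply] at hx1 hx2
    have hτx : τ x = -x := eq_neg_of_add_eq_zero_left hx1
    have hτ2x : (τ ^ 2) x = x := by rw [pow_two, Module.End.mul_apply, hτx, map_neg, hτx, neg_neg]
    rw [hτ2x] at hx2
    have h2x : (2 : K) • x = 0 := by rw [two_smul]; exact hx2
    exact (smul_eq_zero.1 h2x).resolve_left h2
  · rw [codisjoint_iff, eq_top_iff]
    intro x _
    refine Submodule.mem_sup.2 ⟨(2 : K)⁻¹ • ((τ ^ 2) x + x), ?_, (2 : K)⁻¹ • (x - (τ ^ 2) x), ?_, ?_⟩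
    · rw [LinearMap.mem_ker, LinearMap.add_apply, Module.End.one_apply, map_smul, ← smul_add, hfac, smul_zero]
    · rw [LinearMap.mem_ker, LinearMap.add_apply, Module.End.one_apply, map_smul, ← smul_add, map_sub, h4, sub_add_sub_cancel,
        sub_self, smul_zero]
    · rw [← smul_add]
      have : (τ ^ 2) x + x + (x - (τ ^ 2) x) = (2 : K) • x := by rw [two_smul]; abel
      rw [this, smul_smul, inv_mul_cancel₀ h2, one_smul]

/-- **`H²(F) = ker(τ^* + 1) ⊕ ker((τ^*)² + 1)`** for the Milnor fibre of `z₀² + z₁² + z₂⁴` (any field of characteristic zero): the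
`−1`-eigenspace of the covering rotation and the `ι`-invariant part. [cite: Milnor1968, §9 Thm. 9.1 and p. 77] -/
theorem isCompl_ker_cohomologyTauFour [CharZero F] :
    IsCompl (LinearMap.ker (cohomologyTauFour F hζ + 1)) (LinearMap.ker (cohomologyTauFour F hζ ^ 2 + 1)) :=
  isCompl_ker_of_pow_four _ (fun a => by
      rw [← Module.End.mul_apply, ← pow_add]; exact cohomologyTauFour_pow_four F hζ a)
    (cohomologyTauFour_sum_eq_zero F hζ)

/-- `τ^*` preserves `ker((τ^*)² + 1)` and squares to `−1` there. [cite: Milnor1968, §9 Thm. 9.1 and p. 77] -/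
theorem cohomologyTauFour_mem_ker_sq_add_one {a : singularCohomology F F (fibre (cyclicNodeExponents 4)) 2}
    (ha : a ∈ LinearMap.ker (cohomologyTauFour F hζ ^ 2 + 1)) :
    cohomologyTauFour F hζ a ∈ LinearMap.ker (cohomologyTauFour F hζ ^ 2 + 1) ∧
      cohomologyTauFour F hζ (cohomologyTauFour F hζ a) = -a := by
  rw [LinearMap.mem_ker, LinearMap.add_apply, Module.End.one_apply] at ha ⊢
  have h : cohomologyTauFour F hζ (cohomologyTauFour F hζ a) = -a := by
    rw [← Module.End.mul_apply, ← pow_two]; exact eq_neg_of_add_eq_zero_left ha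
  refine ⟨?_, h⟩
  rw [pow_two, Module.End.mul_apply, h, map_neg, neg_add_cancel]

end Cohomology

/-! ### §3 Rational coefficients: `dim_ℚ ker((τ^*)² + 1)` is even, hence `≤ 2` -/

section Rational

variable {ζ : ℂ} (hζ : IsPrimitiveRoot ζ 4)

/-- A rational endomorphism squaring to `−1` lives on an even-dimensional space (`det(J)² = (−1)^{dim}` is a square). [folklore] -/
private theorem even_finrank_of_sq_eq_neg_one {W : Type} [AddCommGroup W] [Module ℚ W] [Module.Finite ℚ W] (J : W →ₗ[ℚ] W)
    (hJ : J * J = (-1 : ℚ) • LinearMap.id) : Even (Module.finrank ℚ W) := by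
  have hdet : LinearMap.det J * LinearMap.det J = (-1 : ℚ) ^ Module.finrank ℚ W := by
    rw [← map_mul, hJ, LinearMap.det_smul, LinearMap.det_id, mul_one]
  by_contra hodd
  rw [Nat.not_even_iff_odd] at hodd
  rw [hodd.neg_one_pow] at hdet
  have h := mul_self_nonneg (LinearMap.det J)
  rw [hdet] at h
  norm_num at h

/-- `H²(F; ℚ)` of the Milnor fibre of `z₀² + z₁² + z₂⁴` is finite-dimensional (dimension `3`). [cite: Milnor1968, §9 Thm. 9.1] -/
theorem finite_rat_singularCohomology_fibre_cyclicNode_four :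
    Module.Finite ℚ (singularCohomology ℚ ℚ (fibre (cyclicNodeExponents 4)) 2) :=
  finite_rat_singularCohomology_fibre_cyclicNode 4 (by norm_num)

/-- **`dim_ℚ ker((τ^*)² + 1)` is even** (`τ^*` restricts to a complex structure). [cite: Milnor1968, §9 Thm. 9.1 and p. 77] -/
theorem even_finrank_ker_cohomologyTauFour_sq_add_one :
    Even (Module.finrank ℚ (LinearMap.ker (cohomologyTauFour ℚ hζ ^ 2 + 1))) := by
  haveI := finite_rat_singularCohomology_fibre_cyclicNode_four
  set W := LinearMap.ker (cohomologyTauFour ℚ hζ ^ 2 + 1) with hW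
  have hmem : ∀ a ∈ W, cohomologyTauFour ℚ hζ a ∈ W := fun a ha => (cohomologyTauFour_mem_ker_sq_add_one ℚ hζ ha).1
  refine even_finrank_of_sq_eq_neg_one ((cohomologyTauFour ℚ hζ).restrict hmem) (LinearMap.ext fun a => Subtype.ext ?_)
  rw [Module.End.mul_apply, LinearMap.smul_apply, LinearMap.id_apply, Submodule.coe_smul, neg_one_smul,
    LinearMap.coe_restrict_apply, LinearMap.coe_restrict_apply]
  exact (cohomologyTauFour_mem_ker_sq_add_one ℚ hζ a.2).2

/-- **`dim_ℚ ker((τ^*)² + 1) ≤ 2`** (`dim_ℚ H²(F; ℚ) = 3`, the decomposition, evenness). [cite: Milnor1968, §9 Thm. 9.1 and p. 77] -/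
theorem finrank_ker_cohomologyTauFour_sq_add_one_le_two :
    Module.finrank ℚ (LinearMap.ker (cohomologyTauFour ℚ hζ ^ 2 + 1)) ≤ 2 := by
  haveI := finite_rat_singularCohomology_fibre_cyclicNode_four
  have hsum := Submodule.finrank_add_eq_of_isCompl (isCompl_ker_cohomologyTauFour ℚ hζ)
  rw [finrank_rat_singularCohomology_fibre_cyclicNode 4 (by norm_num)] at hsum
  obtain ⟨k, hk⟩ := even_finrank_ker_cohomologyTauFour_sq_add_one hζ
  omega

/-- `dim_ℚ ker(τ^* + 1) ≥ 1`. [cite: Milnor1968, §9 Thm. 9.1 and p. 77] -/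
theorem one_le_finrank_ker_cohomologyTauFour_add_one :
    1 ≤ Module.finrank ℚ (LinearMap.ker (cohomologyTauFour ℚ hζ + 1)) := by
  haveI := finite_rat_singularCohomology_fibre_cyclicNode_four
  have hsum := Submodule.finrank_add_eq_of_isCompl (isCompl_ker_cohomologyTauFour ℚ hζ)
  rw [finrank_rat_singularCohomology_fibre_cyclicNode 4 (by norm_num)] at hsum
  have h2 := finrank_ker_cohomologyTauFour_sq_add_one_le_two hζ
  omega

end Rational

end PhamBrieskorn

end Literature.Geometry.ComplexAnalytic

end
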